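import Summits.RiemannHypothesis.RiemannHypothesis.Theorems.WeilColumnThetaMellinTransform
import HarnessLib

/-!
# THETA kernel certificate, analytic layer D3: the `L²` norms of the cut theta TAIL and of its derivative (RH-FREE)

Cell `rh-explicit`, WEIL column, seat handoff-prove-2 gen12; typing lane of `ThetaCertificateSound`
(THETA-KERNEL-BLUEPRINT v1.3 §3(3d)/(P_R); THETA-CERT-cc6 §D3; director I l.7328 (A)(ii) «lane: D3/D4/D7/D8»).
Upper clauses of truncated Weil forms only; nothing here bears on the truth of RH.

ABSTRACT SETTING (the D1/D2 majorants are HYPOTHESES here; cc-s2-3's `WeilColumnThetaMajorantD1` supplies them for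
the PART XIX profile).  `Θ : ℝ → ℂ` with, for `0 < u ≤ u₁ = e^{x₁}`,
`‖Θ u‖ ≤ M (u/u₁)^m` (D1) and `‖u Θ′ u‖ ≤ M₁ (u/u₁)^{m−1}` (D2); a cut `χ : ℝ → ℝ` with `0 ≤ χ ≤ 1`, `χ = 1` on
`[x₁, ∞)`, `|χ′| ≤ L` (`L = m/η′` for the Irwin–Hall cut).  The tail is `T := G₀·(1 − χ)`, `G₀ = expProfile Θ`
(`= e^{x/2}Θ(eˣ)`, tree p412019), its odd extension `T⁻(x) = T(x) − T(−x)`.  PROVED: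

* pointwise envelopes `‖T x‖ ≤ M e^{x/2}(eˣ/u₁)^m` (`= M√u₁·e^{(m+½)(x−x₁)}`, THETA-CERT (★)) and
  `‖T′ x‖ ≤ (½ + L)M e^{x/2}(eˣ/u₁)^m + M₁ e^{x/2}(eˣ/u₁)^{m−1}` for `x ≤ x₁`, `T = T′ = 0` beyond `x₁`;
* `∫‖T‖² ≤ M²u₁/(2m+1)`, `∫‖T′‖² ≤ (½+L)²M²u₁/(2m+1) + 2(½+L)MM₁u₁/(2m) + M₁²u₁/(2m−1)`
  `≤ ((½+L)M√(u₁/(2m+1)) + M₁√(u₁/(2m−1)))²` (the checker's Minkowski shape `Bin²`);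
* (sequel `WeilColumnThetaOddTailNorms`) for `x₁ < 0` the odd extension doubles both: `A := ∫‖T⁻‖² ≤ 2M²u₁/(2m+1)`,
  `B := ∫‖(T⁻)′‖² ≤ 2·Bin²` — the `Ahi`/`Bhi` lets of cc-s2-1's `ThetaTier1Check.check`, as real inequalities.

No measurability of `Θ` is assumed: every integral bound is `integral_mono_of_nonneg` against an explicit
exponential majorant on `(−∞, x₁]`.
-/

noncomputable section

set_option linter.dupNamespace false

open Complex Set MeasureTheory Filter
open scoped Real Topology

namespace Summit.RiemannHypothesis.RiemannHypothesis.Theorems.WeilColumn.ThetaTail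

open Literature.NumberTheory.LFunctions
open Summit.RiemannHypothesis.RiemannHypothesis.Theorems.WeilColumn.ThetaMellin

variable {Θ Θ' : ℝ → ℂ} {χ χ' : ℝ → ℝ} {M M₁ L u₁ x₁ : ℝ} {m : ℕ}

/-! ## §1 The generic half-line exponential integral -/

/-- `∫_{(−∞, x₁]} eˣ (eˣ/u₁)ⁿ dx = u₁/(n+1)` for `u₁ = e^{x₁}`. [folklore] -/
theorem setIntegral_exp_mul_pow_Iic (hu₁ : u₁ = Real.exp x₁) (n : ℕ) :
    ∫ x in Iic x₁, Real.exp x * (Real.exp x / u₁) ^ n = u₁ / (n + 1) := by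
  have hu0 : 0 < u₁ := by rw [hu₁]; exact Real.exp_pos _
  have hpt : ∀ x : ℝ, Real.exp x * (Real.exp x / u₁) ^ n = (u₁ ^ n)⁻¹ * Real.exp (((n : ℝ) + 1) * x) := by
    intro x
    rw [div_pow, ← Real.exp_nat_mul, add_mul, one_mul, Real.exp_add]
    field_simp
  simp_rw [hpt]
  rw [integral_const_mul, integral_exp_mul_Iic (by positivity) x₁]
  have he : Real.exp (((n : ℝ) + 1) * x₁) = u₁ ^ (n + 1) := by
    rw [hu₁, ← Real.exp_nat_mul]; push_cast; ring_nf
  rw [he, pow_succ]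
  field_simp

/-- Integrability of the same integrand on `(−∞, x₁]`. [folklore] -/
theorem integrableOn_exp_mul_pow_Iic (hu₁ : u₁ = Real.exp x₁) (n : ℕ) :
    IntegrableOn (fun x : ℝ ↦ Real.exp x * (Real.exp x / u₁) ^ n) (Iic x₁) := by
  have hu0 : 0 < u₁ := by rw [hu₁]; exact Real.exp_pos _
  have hpt : (fun x : ℝ ↦ Real.exp x * (Real.exp x / u₁) ^ n) =
      fun x : ℝ ↦ (u₁ ^ n)⁻¹ * Real.exp (((n : ℝ) + 1) * x) := by
    funext x
    rw [div_pow, ← Real.exp_nat_mul, add_mul, one_mul, Real.exp_add]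
    field_simp
  rw [hpt]
  exact (integrableOn_exp_mul_Iic (by positivity) x₁).const_mul _

/-! ## §2 The tail and its pointwise envelope (THETA-CERT (★)) -/

/-- Beyond the cut the tail vanishes: `T x = 0` for `x ≥ x₁` (`χ = 1` there). -/
theorem tail_eq_zero (hχ1 : ∀ x, x₁ ≤ x → χ x = 1) {x : ℝ} (hx : x₁ ≤ x) :
    expProfile Θ x * (((1 - χ x : ℝ)) : ℂ) = 0 := by
  rw [hχ1 x hx]; simp

/-- **The envelope of the tail**: `‖T x‖ ≤ M·e^{x/2}·(eˣ/u₁)^m` for `x ≤ x₁` (D1 majorant on `(0, u₁]`, `0 ≤ χ ≤ 1`).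
[THETA-CERT-cc6 §D3 (★)] -/
theorem norm_tail_le (hu₁ : u₁ = Real.exp x₁)
    (hM : ∀ u ∈ Ioc (0 : ℝ) u₁, ‖Θ u‖ ≤ M * (u / u₁) ^ m)
    (hχ01 : ∀ x, χ x ∈ Icc (0 : ℝ) 1) {x : ℝ} (hx : x ≤ x₁) :
    ‖expProfile Θ x * (((1 - χ x : ℝ)) : ℂ)‖ ≤ M * Real.exp (x / 2) * (Real.exp x / u₁) ^ m := by
  have hu : Real.exp x ∈ Ioc (0 : ℝ) u₁ := ⟨Real.exp_pos x, by rw [hu₁]; exact Real.exp_le_exp.2 hx⟩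
  have h1 : ‖(((1 - χ x : ℝ)) : ℂ)‖ ≤ 1 := by
    rw [Complex.norm_real, Real.norm_eq_abs, abs_le]
    constructor <;> linarith [(hχ01 x).1, (hχ01 x).2]
  unfold expProfile
  rw [norm_mul, norm_mul, Complex.norm_real, Real.norm_of_nonneg (Real.exp_pos _).le]
  have hΘ := hM _ hu
  have hM0 : 0 ≤ M * (Real.exp x / u₁) ^ m := (norm_nonneg _).trans hΘ
  have he0 : 0 ≤ Real.exp (x / 2) := (Real.exp_pos _).le
  calc Real.exp (x / 2) * ‖Θ (Real.exp x)‖ * ‖(((1 - χ x : ℝ)) : ℂ)‖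
      ≤ Real.exp (x / 2) * (M * (Real.exp x / u₁) ^ m) * 1 :=
        mul_le_mul (mul_le_mul_of_nonneg_left hΘ he0) h1 (norm_nonneg _) (mul_nonneg he0 hM0)
    _ = M * Real.exp (x / 2) * (Real.exp x / u₁) ^ m := by ring

/-- The envelope in THETA-CERT's shape: `M e^{x/2}(eˣ/u₁)^m = M√u₁·e^{(m+½)(x − x₁)}`. [folklore] -/
theorem envelope_eq (hu₁ : u₁ = Real.exp x₁) (x : ℝ) :
    M * Real.exp (x / 2) * (Real.exp x / u₁) ^ m = M * Real.sqrt u₁ * Real.exp (((m : ℝ) + 1 / 2) * (x - x₁)) := by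
  rw [hu₁, Real.sqrt_eq_rpow, ← Real.exp_mul, ← Real.exp_sub, ← Real.exp_nat_mul, mul_assoc, mul_assoc,
    ← Real.exp_add, ← Real.exp_add]
  congr 2
  ring

/-- **`∫‖T‖² ≤ M²u₁/(2m+1)`** (square the envelope and integrate over `(−∞, x₁]`; `T = 0` beyond). No measurability of `Θ`
is needed. [THETA-CERT-cc6 §D3] -/
theorem integral_norm_sq_tail_le (hu₁ : u₁ = Real.exp x₁)
    (hM : ∀ u ∈ Ioc (0 : ℝ) u₁, ‖Θ u‖ ≤ M * (u / u₁) ^ m)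
    (hχ01 : ∀ x, χ x ∈ Icc (0 : ℝ) 1) (hχ1 : ∀ x, x₁ ≤ x → χ x = 1) :
    ∫ x : ℝ, ‖expProfile Θ x * (((1 - χ x : ℝ)) : ℂ)‖ ^ 2 ≤ M ^ 2 * u₁ / (2 * m + 1) := by
  set env : ℝ → ℝ := (Iic x₁).indicator fun x ↦ M ^ 2 * (Real.exp x * (Real.exp x / u₁) ^ (2 * m)) with henv
  have hint : Integrable env := by
    rw [henv]
    refine IntegrableOn.integrable_indicator ?_ measurableSet_Iic
    exact (integrableOn_exp_mul_pow_Iic hu₁ (2 * m)).const_mul _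
  have hpt : ∀ x : ℝ, ‖expProfile Θ x * (((1 - χ x : ℝ)) : ℂ)‖ ^ 2 ≤ env x := by
    intro x
    by_cases hx : x ≤ x₁
    · rw [henv, indicator_of_mem (show x ∈ Iic x₁ from hx)]
      have h := norm_tail_le hu₁ hM hχ01 hx
      have h0 : 0 ≤ ‖expProfile Θ x * (((1 - χ x : ℝ)) : ℂ)‖ := norm_nonneg _
      calc ‖expProfile Θ x * (((1 - χ x : ℝ)) : ℂ)‖ ^ 2 ≤ (M * Real.exp (x / 2) * (Real.exp x / u₁) ^ m) ^ 2 :=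
            pow_le_pow_left₀ h0 h 2
        _ = M ^ 2 * (Real.exp x * (Real.exp x / u₁) ^ (2 * m)) := by
            rw [show Real.exp x = Real.exp (x / 2) ^ 2 by rw [← Real.exp_nat_mul]; ring_nf]
            ring
    · rw [tail_eq_zero hχ1 (le_of_not_ge hx), norm_zero]
      rw [henv, indicator_of_notMem (show x ∉ Iic x₁ from hx)]
      simp
  calc ∫ x : ℝ, ‖expProfile Θ x * (((1 - χ x : ℝ)) : ℂ)‖ ^ 2 ≤ ∫ x, env x :=
        integral_mono_of_nonneg (Eventually.of_forall fun x ↦ by positivity) hint (Eventually.of_forall hpt)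
    _ = M ^ 2 * u₁ / (2 * m + 1) := by
        rw [henv, integral_indicator measurableSet_Iic, integral_const_mul, setIntegral_exp_mul_pow_Iic hu₁]
        push_cast
        ring

/-! ## §3 The derivative of the tail -/

/-- The derivative of the tail: `T′ = e^{x/2}(½Θ(eˣ) + eˣΘ′(eˣ))(1 − χ) − e^{x/2}Θ(eˣ)χ′`. -/
theorem hasDerivAt_tail (hΘ' : ∀ u : ℝ, 0 < u → HasDerivAt Θ (Θ' u) u) (hχ' : ∀ x, HasDerivAt χ (χ' x) x)
    (x : ℝ) :
    HasDerivAt (fun x : ℝ ↦ expProfile Θ x * (((1 - χ x : ℝ)) : ℂ))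
      ((Real.exp (x / 2) : ℂ) * ((1 / 2 : ℂ) * Θ (Real.exp x) + (Real.exp x : ℂ) * Θ' (Real.exp x)) *
          (((1 - χ x : ℝ)) : ℂ) -
        (Real.exp (x / 2) : ℂ) * Θ (Real.exp x) * (χ' x : ℂ)) x := by
  -- the factor `e^{x/2}`
  have h1 : HasDerivAt (fun x : ℝ ↦ (Real.exp (x / 2) : ℂ)) (((Real.exp (x / 2) * (1 / 2) : ℝ)) : ℂ) x := by
    refine HasDerivAt.ofReal_comp ?_
    exact ((hasDerivAt_id' x).div_const 2).exp
  -- the factor `Θ(eˣ)`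
  have h2 : HasDerivAt (fun x : ℝ ↦ Θ (Real.exp x)) (Real.exp x • Θ' (Real.exp x)) x :=
    (hΘ' _ (Real.exp_pos x)).scomp x (Real.hasDerivAt_exp x)
  -- the factor `1 − χ`
  have h3 : HasDerivAt (fun x : ℝ ↦ (((1 - χ x : ℝ)) : ℂ)) (((-χ' x : ℝ)) : ℂ) x :=
    HasDerivAt.ofReal_comp ((hχ' x).const_sub 1)
  have h12 := h1.fun_mul h2
  have h := h12.fun_mul h3
  refine h.congr_deriv ?_
  simp only [Complex.real_smul]
  push_cast
  ring

/-- Beyond the cut the derivative vanishes too: for `x > x₁`, `χ′ x = 0` (`χ ≡ 1` near `x`) and `1 − χ x = 0`. -/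
theorem deriv_tail_eq_zero (hχ1 : ∀ x, x₁ ≤ x → χ x = 1) (hχ' : ∀ x, HasDerivAt χ (χ' x) x) {x : ℝ}
    (hx : x₁ < x) :
    (Real.exp (x / 2) : ℂ) * ((1 / 2 : ℂ) * Θ (Real.exp x) + (Real.exp x : ℂ) * Θ' (Real.exp x)) *
          (((1 - χ x : ℝ)) : ℂ) -
        (Real.exp (x / 2) : ℂ) * Θ (Real.exp x) * (χ' x : ℂ) = 0 := by
  have hχ'0 : χ' x = 0 := by
    have hev : χ =ᶠ[𝓝 x] fun _ ↦ (1 : ℝ) := by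
      filter_upwards [Ioi_mem_nhds hx] with y hy using hχ1 y (le_of_lt hy)
    have h0 : HasDerivAt χ 0 x := (hasDerivAt_const x (1 : ℝ)).congr_of_eventuallyEq hev
    exact (hχ' x).unique h0
  rw [hχ1 x hx.le, hχ'0]; simp

/-- **The envelope of the derivative**: for `x ≤ x₁`,
`‖T′ x‖ ≤ (½ + L)M e^{x/2}(eˣ/u₁)^m + M₁ e^{x/2}(eˣ/u₁)^{m−1}`. [THETA-CERT-cc6 §D3] -/
theorem norm_deriv_tail_le (hu₁ : u₁ = Real.exp x₁)
    (hM : ∀ u ∈ Ioc (0 : ℝ) u₁, ‖Θ u‖ ≤ M * (u / u₁) ^ m)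
    (hM₁ : ∀ u ∈ Ioc (0 : ℝ) u₁, ‖(u : ℂ) * Θ' u‖ ≤ M₁ * (u / u₁) ^ (m - 1))
    (hχ01 : ∀ x, χ x ∈ Icc (0 : ℝ) 1) (hL : ∀ x, |χ' x| ≤ L) {x : ℝ} (hx : x ≤ x₁) :
    ‖(Real.exp (x / 2) : ℂ) * ((1 / 2 : ℂ) * Θ (Real.exp x) + (Real.exp x : ℂ) * Θ' (Real.exp x)) *
          (((1 - χ x : ℝ)) : ℂ) -
        (Real.exp (x / 2) : ℂ) * Θ (Real.exp x) * (χ' x : ℂ)‖ ≤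
      (1 / 2 + L) * M * Real.exp (x / 2) * (Real.exp x / u₁) ^ m +
        M₁ * Real.exp (x / 2) * (Real.exp x / u₁) ^ (m - 1) := by
  have hu : Real.exp x ∈ Ioc (0 : ℝ) u₁ := ⟨Real.exp_pos x, by rw [hu₁]; exact Real.exp_le_exp.2 hx⟩
  have hΘ := hM _ hu
  have hΘ' := hM₁ _ hu
  have hχ := hL x
  have h1 : ‖(((1 - χ x : ℝ)) : ℂ)‖ ≤ 1 := by
    rw [Complex.norm_real, Real.norm_eq_abs, abs_le]
    constructor <;> linarith [(hχ01 x).1, (hχ01 x).2]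
  have he : ‖(Real.exp (x / 2) : ℂ)‖ = Real.exp (x / 2) := by
    rw [Complex.norm_real, Real.norm_of_nonneg (Real.exp_pos _).le]
  have hχn : ‖(χ' x : ℂ)‖ ≤ L := by rw [Complex.norm_real, Real.norm_eq_abs]; exact hχ
  have hM0 : 0 ≤ M * (Real.exp x / u₁) ^ m := le_trans (norm_nonneg _) hΘ
  have he0 : 0 ≤ Real.exp (x / 2) := (Real.exp_pos _).le
  -- first product
  have hA : ‖(Real.exp (x / 2) : ℂ) * ((1 / 2 : ℂ) * Θ (Real.exp x) + (Real.exp x : ℂ) * Θ' (Real.exp x)) *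
      (((1 - χ x : ℝ)) : ℂ)‖ ≤ Real.exp (x / 2) * ((1 / 2) * (M * (Real.exp x / u₁) ^ m) +
        M₁ * (Real.exp x / u₁) ^ (m - 1)) := by
    rw [norm_mul, norm_mul, he]
    have hin : ‖(1 / 2 : ℂ) * Θ (Real.exp x) + (Real.exp x : ℂ) * Θ' (Real.exp x)‖ ≤
        (1 / 2) * (M * (Real.exp x / u₁) ^ m) + M₁ * (Real.exp x / u₁) ^ (m - 1) := by
      refine (norm_add_le _ _).trans (add_le_add ?_ hΘ')
      rw [norm_mul, show ‖(1 / 2 : ℂ)‖ = 1 / 2 by norm_num]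
      exact mul_le_mul_of_nonneg_left hΘ (by norm_num)
    have hin0 : 0 ≤ ‖(1 / 2 : ℂ) * Θ (Real.exp x) + (Real.exp x : ℂ) * Θ' (Real.exp x)‖ := norm_nonneg _
    have hs0 : 0 ≤ (1 / 2) * (M * (Real.exp x / u₁) ^ m) + M₁ * (Real.exp x / u₁) ^ (m - 1) := hin0.trans hin
    calc Real.exp (x / 2) * ‖(1 / 2 : ℂ) * Θ (Real.exp x) + (Real.exp x : ℂ) * Θ' (Real.exp x)‖ *
          ‖(((1 - χ x : ℝ)) : ℂ)‖
        ≤ Real.exp (x / 2) * ((1 / 2) * (M * (Real.exp x / u₁) ^ m) + M₁ * (Real.exp x / u₁) ^ (m - 1)) * 1 :=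
          mul_le_mul (mul_le_mul_of_nonneg_left hin he0) h1 (norm_nonneg _) (mul_nonneg he0 hs0)
      _ = _ := mul_one _
  -- second product
  have hB : ‖(Real.exp (x / 2) : ℂ) * Θ (Real.exp x) * (χ' x : ℂ)‖ ≤
      Real.exp (x / 2) * (M * (Real.exp x / u₁) ^ m) * L := by
    rw [norm_mul, norm_mul, he]
    exact mul_le_mul (mul_le_mul_of_nonneg_left hΘ he0) hχn (norm_nonneg _) (mul_nonneg he0 hM0)
  calc _ ≤ ‖(Real.exp (x / 2) : ℂ) * ((1 / 2 : ℂ) * Θ (Real.exp x) + (Real.exp x : ℂ) * Θ' (Real.exp x)) *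
          (((1 - χ x : ℝ)) : ℂ)‖ + ‖(Real.exp (x / 2) : ℂ) * Θ (Real.exp x) * (χ' x : ℂ)‖ := norm_sub_le _ _
    _ ≤ Real.exp (x / 2) * ((1 / 2) * (M * (Real.exp x / u₁) ^ m) + M₁ * (Real.exp x / u₁) ^ (m - 1)) +
          Real.exp (x / 2) * (M * (Real.exp x / u₁) ^ m) * L := add_le_add hA hB
    _ = (1 / 2 + L) * M * Real.exp (x / 2) * (Real.exp x / u₁) ^ m +
          M₁ * Real.exp (x / 2) * (Real.exp x / u₁) ^ (m - 1) := by ring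

/-- **`∫‖T′‖² ≤ (½+L)²M²u₁/(2m+1) + 2(½+L)MM₁u₁/(2m) + M₁²u₁/(2m−1)`** for `m ≥ 1` (square the two-term envelope and
integrate exactly; tighter than Minkowski). [THETA-CERT-cc6 §D3] -/
theorem integral_norm_sq_deriv_tail_le (hm : 1 ≤ m) (hu₁ : u₁ = Real.exp x₁)
    (hM : ∀ u ∈ Ioc (0 : ℝ) u₁, ‖Θ u‖ ≤ M * (u / u₁) ^ m)
    (hM₁ : ∀ u ∈ Ioc (0 : ℝ) u₁, ‖(u : ℂ) * Θ' u‖ ≤ M₁ * (u / u₁) ^ (m - 1))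
    (hχ01 : ∀ x, χ x ∈ Icc (0 : ℝ) 1) (hχ1 : ∀ x, x₁ ≤ x → χ x = 1) (hχ' : ∀ x, HasDerivAt χ (χ' x) x)
    (hL : ∀ x, |χ' x| ≤ L) :
    ∫ x : ℝ, ‖(Real.exp (x / 2) : ℂ) * ((1 / 2 : ℂ) * Θ (Real.exp x) + (Real.exp x : ℂ) * Θ' (Real.exp x)) *
          (((1 - χ x : ℝ)) : ℂ) -
        (Real.exp (x / 2) : ℂ) * Θ (Real.exp x) * (χ' x : ℂ)‖ ^ 2 ≤
      ((1 / 2 + L) * M) ^ 2 * (u₁ / (2 * m + 1)) + 2 * ((1 / 2 + L) * M) * M₁ * (u₁ / (2 * m)) +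
        M₁ ^ 2 * (u₁ / (2 * m - 1)) := by
  set a : ℝ := (1 / 2 + L) * M with ha
  set env : ℝ → ℝ := (Iic x₁).indicator fun x ↦
    a ^ 2 * (Real.exp x * (Real.exp x / u₁) ^ (2 * m)) + 2 * a * M₁ * (Real.exp x * (Real.exp x / u₁) ^ (2 * m - 1)) +
      M₁ ^ 2 * (Real.exp x * (Real.exp x / u₁) ^ (2 * m - 2)) with henv
  have hint : Integrable env := by
    rw [henv]
    refine IntegrableOn.integrable_indicator ?_ measurableSet_Iic
    exact (((integrableOn_exp_mul_pow_Iic hu₁ (2 * m)).const_mul _).add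
      ((integrableOn_exp_mul_pow_Iic hu₁ (2 * m - 1)).const_mul _)).add
      ((integrableOn_exp_mul_pow_Iic hu₁ (2 * m - 2)).const_mul _)
  -- exponent bookkeeping: `e^{x/2}·e^{x/2} = eˣ`, `r^m r^m = r^{2m}`, `r^m r^{m−1} = r^{2m−1}`, `r^{m−1} r^{m−1} = r^{2m−2}`
  have hsq : ∀ x : ℝ, Real.exp (x / 2) * Real.exp (x / 2) = Real.exp x := by
    intro x; rw [← Real.exp_add]; ring_nf
  have hp1 : m + m = 2 * m := by ring
  have hp2 : m + (m - 1) = 2 * m - 1 := by omega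
  have hp3 : (m - 1) + (m - 1) = 2 * m - 2 := by omega
  have hpt : ∀ x : ℝ, ‖(Real.exp (x / 2) : ℂ) * ((1 / 2 : ℂ) * Θ (Real.exp x) + (Real.exp x : ℂ) * Θ' (Real.exp x)) *
          (((1 - χ x : ℝ)) : ℂ) -
        (Real.exp (x / 2) : ℂ) * Θ (Real.exp x) * (χ' x : ℂ)‖ ^ 2 ≤ env x := by
    intro x
    by_cases hx : x ≤ x₁
    · rw [henv, indicator_of_mem (show x ∈ Iic x₁ from hx)]
      have h := norm_deriv_tail_le hu₁ hM hM₁ hχ01 hL hx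
      have h0 := norm_nonneg ((Real.exp (x / 2) : ℂ) * ((1 / 2 : ℂ) * Θ (Real.exp x) +
        (Real.exp x : ℂ) * Θ' (Real.exp x)) * (((1 - χ x : ℝ)) : ℂ) - (Real.exp (x / 2) : ℂ) * Θ (Real.exp x) * (χ' x : ℂ))
      refine (pow_le_pow_left₀ h0 h 2).trans (le_of_eq ?_)
      set r : ℝ := Real.exp x / u₁ with hr
      have e1 : r ^ m * r ^ m = r ^ (2 * m) := by rw [← pow_add, hp1]
      have e2 : r ^ m * r ^ (m - 1) = r ^ (2 * m - 1) := by rw [← pow_add, hp2]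
      have e3 : r ^ (m - 1) * r ^ (m - 1) = r ^ (2 * m - 2) := by rw [← pow_add, hp3]
      rw [ha]
      calc ((1 / 2 + L) * M * Real.exp (x / 2) * r ^ m + M₁ * Real.exp (x / 2) * r ^ (m - 1)) ^ 2
          = ((1 / 2 + L) * M) ^ 2 * ((Real.exp (x / 2) * Real.exp (x / 2)) * (r ^ m * r ^ m)) +
              2 * ((1 / 2 + L) * M) * M₁ * ((Real.exp (x / 2) * Real.exp (x / 2)) * (r ^ m * r ^ (m - 1))) +
              M₁ ^ 2 * ((Real.exp (x / 2) * Real.exp (x / 2)) * (r ^ (m - 1) * r ^ (m - 1))) := by ring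
        _ = _ := by rw [hsq, e1, e2, e3]
    · have hx' : x₁ < x := lt_of_not_ge hx
      rw [deriv_tail_eq_zero hχ1 hχ' hx', norm_zero, henv, indicator_of_notMem (show x ∉ Iic x₁ from hx)]
      simp
  have hm1 : ((2 * m - 1 : ℕ) : ℝ) = 2 * m - 1 := by
    rw [Nat.cast_sub (by omega)]; push_cast; ring
  have hm2 : ((2 * m - 2 : ℕ) : ℝ) = 2 * m - 2 := by
    rw [Nat.cast_sub (by omega)]; push_cast; ring
  calc _ ≤ ∫ x, env x :=
        integral_mono_of_nonneg (Eventually.of_forall fun x ↦ by positivity) hint (Eventually.of_forall hpt)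
    _ = a ^ 2 * (u₁ / (2 * m + 1)) + 2 * a * M₁ * (u₁ / (2 * m)) + M₁ ^ 2 * (u₁ / (2 * m - 1)) := by
        rw [henv, integral_indicator measurableSet_Iic]
        have i1 := (integrableOn_exp_mul_pow_Iic hu₁ (2 * m)).const_mul (a ^ 2)
        have i2 := (integrableOn_exp_mul_pow_Iic hu₁ (2 * m - 1)).const_mul (2 * a * M₁)
        have i3 := (integrableOn_exp_mul_pow_Iic hu₁ (2 * m - 2)).const_mul (M₁ ^ 2)
        have i12 : IntegrableOn (fun x : ℝ ↦ a ^ 2 * (Real.exp x * (Real.exp x / u₁) ^ (2 * m)) +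
            2 * a * M₁ * (Real.exp x * (Real.exp x / u₁) ^ (2 * m - 1))) (Iic x₁) := i1.add i2
        rw [integral_add i12 i3, integral_add i1 i2, integral_const_mul, integral_const_mul,
          integral_const_mul, setIntegral_exp_mul_pow_Iic hu₁, setIntegral_exp_mul_pow_Iic hu₁,
          setIntegral_exp_mul_pow_Iic hu₁, hm1, hm2]
        push_cast
        ring_nf

/-- The exact-square bound implies the checker's Minkowski shape:
`(½+L)²M²u₁/(2m+1) + 2(½+L)MM₁u₁/(2m) + M₁²u₁/(2m−1) ≤ ((½+L)M√(u₁/(2m+1)) + M₁√(u₁/(2m−1)))²`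
(`1/(2m) ≤ 1/√((2m+1)(2m−1))`), for `M, M₁, ½+L, u₁ ≥ 0`. [folklore] -/
theorem sq_envelope_le_minkowski (hm : 1 ≤ m) (hM : 0 ≤ M) (hM₁ : 0 ≤ M₁) (hL : 0 ≤ 1 / 2 + L) (hu : 0 ≤ u₁) :
    ((1 / 2 + L) * M) ^ 2 * (u₁ / (2 * m + 1)) + 2 * ((1 / 2 + L) * M) * M₁ * (u₁ / (2 * m)) +
        M₁ ^ 2 * (u₁ / (2 * m - 1)) ≤
      ((1 / 2 + L) * M * Real.sqrt (u₁ / (2 * m + 1)) + M₁ * Real.sqrt (u₁ / (2 * m - 1))) ^ 2 := by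
  have hm' : (1 : ℝ) ≤ m := by exact_mod_cast hm
  have h1 : 0 < (2 * (m : ℝ) + 1) := by linarith
  have h2 : 0 < (2 * (m : ℝ) - 1) := by linarith
  have h3 : 0 < (2 * (m : ℝ)) := by linarith
  have hs1 : Real.sqrt (u₁ / (2 * m + 1)) ^ 2 = u₁ / (2 * m + 1) := Real.sq_sqrt (by positivity)
  have hs2 : Real.sqrt (u₁ / (2 * m - 1)) ^ 2 = u₁ / (2 * m - 1) := Real.sq_sqrt (div_nonneg hu h2.le)
  -- the cross term: `u₁/(2m) ≤ √(u₁/(2m+1))·√(u₁/(2m−1))`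
  have hcross : u₁ / (2 * m) ≤ Real.sqrt (u₁ / (2 * m + 1)) * Real.sqrt (u₁ / (2 * m - 1)) := by
    rw [← Real.sqrt_mul (by positivity)]
    refine Real.le_sqrt_of_sq_le ?_
    rw [div_mul_div_comm, div_pow, div_le_div_iff₀ (by positivity) (mul_pos h1 h2)]
    have : (2 * (m : ℝ) + 1) * (2 * m - 1) ≤ (2 * m) ^ 2 := by nlinarith
    calc u₁ ^ 2 * ((2 * (m : ℝ) + 1) * (2 * m - 1)) ≤ u₁ ^ 2 * (2 * m) ^ 2 :=
          mul_le_mul_of_nonneg_left this (sq_nonneg _)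
      _ = u₁ * u₁ * (2 * m) ^ 2 := by ring
  set a := (1 / 2 + L) * M with ha
  have ha0 : 0 ≤ a := mul_nonneg hL hM
  set s1 := Real.sqrt (u₁ / (2 * m + 1))
  set s2 := Real.sqrt (u₁ / (2 * m - 1))
  have key : 2 * a * M₁ * (u₁ / (2 * m)) ≤ 2 * a * M₁ * (s1 * s2) :=
    mul_le_mul_of_nonneg_left hcross (by positivity)
  calc a ^ 2 * (u₁ / (2 * m + 1)) + 2 * a * M₁ * (u₁ / (2 * m)) + M₁ ^ 2 * (u₁ / (2 * m - 1))
      ≤ a ^ 2 * (u₁ / (2 * m + 1)) + 2 * a * M₁ * (s1 * s2) + M₁ ^ 2 * (u₁ / (2 * m - 1)) := by linarith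
    _ = (a * s1 + M₁ * s2) ^ 2 := by rw [← hs1, ← hs2]; ring

end Summit.RiemannHypothesis.RiemannHypothesis.Theorems.WeilColumn.ThetaTail

end
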